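import Summits.Ventures.YMGap.Thresholds.ConnectedFourPointDecay
import Summits.Ventures.YMGap.Thresholds.CouplingSecondDerivative
import HarnessLib

/-!
# Venture YMGap — C-DIFF3: the strong-coupling `SU(2)` state is `C³` in the coupling;
# `d³/dβ_W³ ⟨F⟩ = Σ_q Σ_r Σ_s u₄(F; W_q; W_r; W_s)` (absolutely summable)

HONEST FRAMING: venture file of the cell `pub-ymgap` (QuantumFields programme), seat ds-1 (gen 10).  Strong-coupling LATTICE
statements for `SU(2)` lattice Yang–Mills on `ℤ^4` with the Wilson action inside the one-sided vertex-star window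
`0 < β_W < β₁ ≤ 9/25`; regularity of the unique DLR state in the coupling — `C³`, NOT analyticity; nothing about the continuum
or the Clay problem.
* `su2_summable_fourPoint`, `su2_summable_fourPoint_two` — C-SUS4: `Σ_s |u₄(F; W_q; W_r; W_s)| ≤ A₄ G₄ ρ^{‖x₀−x_q‖₁} ρ^{‖x₀−x_r‖₁}`,
  `Σ_r |Σ_s u₄| ≤ A₄ G₄² ρ^{‖x₀−x_q‖₁}` (`ConnectedFourPointDecay`);
* ★ `su2_hasDerivAt_threePoint_star` — `d/dβ_W u₃(F; W_q; W_r)_{μ β_W} = Σ_s u₄(F; W_q; W_r; W_s)_{μ β_W}` (product rule on the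
  derivative form; g8's C-DIFF and g10's `su2_hasDerivAt_cov_plaquette_star`);
* ★★ `su2_hasDerivAt_threePointSum_star` — termwise differentiation of the double three-point sum (twice
  `hasDerivAt_tsum_of_isPreconnected`, domination by C-SUS4);
* ★★ `su2_hasDerivAt_deriv_deriv_integral_star` — `d³/dβ_W³ ⟨F⟩_{μ β_W} = Σ_q Σ_r Σ_s u₄` on `(0, β₁)`.
Continuity of the triple sum and `ContDiffOn ℝ 3` follow in `CouplingThirdDerivativeContDiff`.

References (mechanism only): Dobrushin–Shlosman (1985/87); Duneau–Iagolnitzer–Souillard (1973); B. Simon (1993) §IV.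
-/

noncomputable section

open MeasureTheory ProbabilityTheory Function Finset Filter Topology Real Set
open scoped NNReal
open Literature.MathematicalPhysics.QuantumLattice (LGConfig ZdEdge ZdPlaquette plaquetteEdges fundamentalRep
  ymGibbsMeasures)
open Literature.MathematicalPhysics.QuantumFieldTheory hiding ZdEdge
open Summit.Ventures.YMGap.DSWindow (starRate starRate_pos)
open Summit.Ventures.YMGap.StarWindowGauge (gaugeR gaugeR_lt_one_of_le)
open Summit.Ventures.YMGap.StarLemmaG (gaugeR_nonneg)
open Summit.Ventures.YMGap.RobustBall (l1 l1_sub_comm numOrient)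
open Summit.Ventures.YMGap.LinearResponseBound (summable_and_tsum_base_le)

namespace Summit.Ventures.YMGap.CouplingResponse

/-- Local shorthand: the normalised plaquette observable `W_q = ½ Re tr U_q` of `SU(2)` on `ℤ⁴`. -/
local notation3 (prettyPrint := false) "W∗" q:max =>
  zdPlaquetteObs (d := 4) (fundamentalRep (Fin 2)) (Prod.fst q) (Prod.snd q).1.1 (Prod.snd q).1.2

/-- Local shorthand: the connected three-point function `u₃(X; Y; Z)` under `μ`. -/
local notation3 (prettyPrint := false) "U₃[" X ";" Y ";" Z ";" μ "]" =>
  cov[fun ω => X ω * Y ω, Z; μ] - (∫ ω, X ω ∂μ) * cov[Y, Z; μ] - (∫ ω, Y ω ∂μ) * cov[X, Z; μ]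

/-- Local shorthand: the connected four-point function in derivative form `u₄(X; Y; Z; W)` under `μ`. -/
local notation3 (prettyPrint := false) "U₄[" X ";" Y ";" Z ";" W ";" μ "]" =>
  (cov[fun ω => (X ω * Y ω) * Z ω, W; μ] - (∫ ω, X ω * Y ω ∂μ) * cov[Z, W; μ] - (∫ ω, Z ω ∂μ) * cov[fun ω => X ω * Y ω, W; μ])
  - cov[X, W; μ] * cov[Y, Z; μ] - (∫ ω, X ω ∂μ) * U₃[Y ; Z ; W ; μ]
  - cov[Y, W; μ] * cov[X, Z; μ] - (∫ ω, Y ω ∂μ) * U₃[X ; Z ; W ; μ]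

/-! ### §1 C-SUS4: the four-point sums converge absolutely -/

section Summable

/-- **C-SUS4 (one sum)**: for the DLR state at `0 ≤ β_W ≤ β₁ ≤ 9/25`, a Lipschitz cylinder `F` and plaquettes `q, r`,
`s ↦ u₄(F; W_q; W_r; W_s)` is summable and `Σ_s |u₄| ≤ A₄ ρ^{‖x₀−x_q‖₁} ρ^{‖x₀−x_r‖₁} · D₄((1+ρ)/(1−ρ))⁴`, `ρ = e^{−κ/36}`. -/
theorem su2_summable_fourPoint {β₁ : ℝ} (h1 : β₁ ≤ 9 / 25) {βW : ℝ} (h0 : 0 ≤ βW) (hβ : βW ≤ β₁)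
    {μ : Measure (LGConfig 4 (Matrix.specialUnitaryGroup (Fin 2) ℂ))}
    (hμ : μ ∈ ymGibbsMeasures (d := 4) (fundamentalRep (Fin 2)) (2 * (βW / 4)))
    {F : LGConfig 4 (Matrix.specialUnitaryGroup (Fin 2) ℂ) → ℝ} {Λ : Finset (ZdEdge 4)} {K : ℝ≥0}
    (hF : IsLipschitzCylinder (fundamentalRep (Fin 2)) F Λ K)
    {x₀ : Literature.Probability.LatticeModels.Site 4} {D : ℕ} (hD : ∀ e ∈ Λ, ‖e.1 - x₀‖ ≤ D)
    (q r : ZdPlaquette 4) :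
    Summable (fun s : ZdPlaquette 4 => U₄[F ; W∗ q ; W∗ r ; W∗ s ; μ]) ∧
      ∑' s : ZdPlaquette 4, |U₄[F ; W∗ q ; W∗ r ; W∗ s ; μ]| ≤
      4 * (2 * Real.sqrt 2) ^ 2 * Real.exp (starRate (gaugeR β₁) * (D + 4)) *
        (40 * ((Λ.card : ℝ) + 4) ^ 2 * (|F 1| + 2 * K + 1) ^ 2 * ((K : ℝ) + 32) ^ 2) *
        Real.exp (-(starRate (gaugeR β₁) / 36)) ^ l1 (x₀ - q.1) * Real.exp (-(starRate (gaugeR β₁) / 36)) ^ l1 (x₀ - r.1) *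
        (numOrient 4 * ((1 + Real.exp (-(starRate (gaugeR β₁) / 36))) / (1 - Real.exp (-(starRate (gaugeR β₁) / 36)))) ^ 4) := by
  have hβ₁0 : 0 ≤ β₁ := h0.trans hβ
  have hκ : 0 < starRate (gaugeR β₁) :=
    starRate_pos (gaugeR_nonneg hβ₁0 (by linarith)) (gaugeR_lt_one_of_le hβ₁0 h1)
  set ρ : ℝ := Real.exp (-(starRate (gaugeR β₁) / 36)) with hρ
  set A : ℝ := 4 * (2 * Real.sqrt 2) ^ 2 * Real.exp (starRate (gaugeR β₁) * (D + 4)) *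
    (40 * ((Λ.card : ℝ) + 4) ^ 2 * (|F 1| + 2 * K + 1) ^ 2 * ((K : ℝ) + 32) ^ 2) with hA
  have hρ0 : 0 ≤ ρ := (Real.exp_pos _).le
  have hρ1 : ρ < 1 := Real.exp_lt_one_iff.2 (by linarith)
  have hK0 : (0 : ℝ) ≤ K := K.2
  have hc : 0 ≤ A * ρ ^ l1 (x₀ - q.1) * ρ ^ l1 (x₀ - r.1) := by positivity
  have h₀ := summable_and_tsum_base_le (d := 4) hc hρ0 hρ1 x₀
  have hpt : ∀ s : ZdPlaquette 4, |U₄[F ; W∗ q ; W∗ r ; W∗ s ; μ]| ≤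
      A * ρ ^ l1 (x₀ - q.1) * ρ ^ l1 (x₀ - r.1) * ρ ^ l1 (x₀ - s.1) := by
    intro s
    have h := su2_abs_fourPoint_le h1 h0 hβ hμ hF hD q r s
    rw [← hρ, ← hA] at h
    exact h
  have hsum : Summable fun s : ZdPlaquette 4 => |U₄[F ; W∗ q ; W∗ r ; W∗ s ; μ]| :=
    Summable.of_nonneg_of_le (fun s => abs_nonneg _) hpt h₀.1
  exact ⟨hsum.of_abs, (hsum.tsum_le_tsum hpt h₀.1).trans h₀.2⟩

/-- **C-SUS4 (two sums)**: `r ↦ Σ_s u₄(F; W_q; W_r; W_s)` is absolutely summable and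
`Σ_r |Σ_s u₄| ≤ A₄ G₄² ρ^{‖x₀−x_q‖₁}`, `G₄ = D₄((1+ρ)/(1−ρ))⁴`. -/
theorem su2_summable_fourPoint_two {β₁ : ℝ} (h1 : β₁ ≤ 9 / 25) {βW : ℝ} (h0 : 0 ≤ βW) (hβ : βW ≤ β₁)
    {μ : Measure (LGConfig 4 (Matrix.specialUnitaryGroup (Fin 2) ℂ))}
    (hμ : μ ∈ ymGibbsMeasures (d := 4) (fundamentalRep (Fin 2)) (2 * (βW / 4)))
    {F : LGConfig 4 (Matrix.specialUnitaryGroup (Fin 2) ℂ) → ℝ} {Λ : Finset (ZdEdge 4)} {K : ℝ≥0}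
    (hF : IsLipschitzCylinder (fundamentalRep (Fin 2)) F Λ K)
    {x₀ : Literature.Probability.LatticeModels.Site 4} {D : ℕ} (hD : ∀ e ∈ Λ, ‖e.1 - x₀‖ ≤ D)
    (q : ZdPlaquette 4) :
    Summable (fun r : ZdPlaquette 4 => ‖∑' s : ZdPlaquette 4, U₄[F ; W∗ q ; W∗ r ; W∗ s ; μ]‖) ∧
      ∑' r : ZdPlaquette 4, ‖∑' s : ZdPlaquette 4, U₄[F ; W∗ q ; W∗ r ; W∗ s ; μ]‖ ≤
      4 * (2 * Real.sqrt 2) ^ 2 * Real.exp (starRate (gaugeR β₁) * (D + 4)) *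
        (40 * ((Λ.card : ℝ) + 4) ^ 2 * (|F 1| + 2 * K + 1) ^ 2 * ((K : ℝ) + 32) ^ 2) *
        Real.exp (-(starRate (gaugeR β₁) / 36)) ^ l1 (x₀ - q.1) *
        (numOrient 4 * ((1 + Real.exp (-(starRate (gaugeR β₁) / 36))) / (1 - Real.exp (-(starRate (gaugeR β₁) / 36)))) ^ 4) ^ 2 := by
  have hβ₁0 : 0 ≤ β₁ := h0.trans hβ
  have hκ : 0 < starRate (gaugeR β₁) :=
    starRate_pos (gaugeR_nonneg hβ₁0 (by linarith)) (gaugeR_lt_one_of_le hβ₁0 h1)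
  set ρ : ℝ := Real.exp (-(starRate (gaugeR β₁) / 36)) with hρ
  set A : ℝ := 4 * (2 * Real.sqrt 2) ^ 2 * Real.exp (starRate (gaugeR β₁) * (D + 4)) *
    (40 * ((Λ.card : ℝ) + 4) ^ 2 * (|F 1| + 2 * K + 1) ^ 2 * ((K : ℝ) + 32) ^ 2) with hA
  set G : ℝ := numOrient 4 * ((1 + ρ) / (1 - ρ)) ^ 4 with hG
  have hρ0 : 0 ≤ ρ := (Real.exp_pos _).le
  have hρ1 : ρ < 1 := Real.exp_lt_one_iff.2 (by linarith)
  have hK0 : (0 : ℝ) ≤ K := K.2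
  have hG0 : 0 ≤ G := by
    have : 0 < 1 - ρ := by linarith
    positivity
  have hc : 0 ≤ A * ρ ^ l1 (x₀ - q.1) * G := by positivity
  have h₀ := summable_and_tsum_base_le (d := 4) hc hρ0 hρ1 x₀
  have hpt : ∀ r : ZdPlaquette 4, ‖∑' s : ZdPlaquette 4, U₄[F ; W∗ q ; W∗ r ; W∗ s ; μ]‖ ≤
      A * ρ ^ l1 (x₀ - q.1) * G * ρ ^ l1 (x₀ - r.1) := by
    intro r
    obtain ⟨hs, hle⟩ := su2_summable_fourPoint h1 h0 hβ hμ hF hD q r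
    rw [← hρ, ← hA, ← hG] at hle
    refine (norm_tsum_le_tsum_norm hs.norm).trans ?_
    simp only [Real.norm_eq_abs]
    linarith
  have hsum : Summable fun r : ZdPlaquette 4 => ‖∑' s : ZdPlaquette 4, U₄[F ; W∗ q ; W∗ r ; W∗ s ; μ]‖ :=
    Summable.of_nonneg_of_le (fun r => norm_nonneg _) hpt h₀.1
  refine ⟨hsum, (hsum.tsum_le_tsum hpt h₀.1).trans (h₀.2.trans (le_of_eq ?_))⟩
  ring

end Summable

/-! ### §2 One term: `u₃(F; W_q; W_r)` is differentiable with derivative `Σ_s u₄` -/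

section OneTerm

/-- ★ **The derivative of one three-point term**: for `β₁ ≤ 9/25`, any DLR selection `μ` on `[0, β₁]`, every Lipschitz cylinder
`F`, plaquettes `q, r`, at every `0 < β_W < β₁`: `d/dβ_W u₃(F; W_q; W_r)_{μ β_W} = Σ_s u₄(F; W_q; W_r; W_s)_{μ β_W}` — the
derivative form of `u₄` is exactly the product rule applied to `u₃ = Cov(FW_q, W_r) − E F · Cov(W_q, W_r) − E W_q · Cov(F, W_r)`
(g8's C-DIFF for the means, `su2_hasDerivAt_cov_plaquette_star` for the covariances). -/
theorem su2_hasDerivAt_threePoint_star {β₁ : ℝ} (h1 : β₁ ≤ 9 / 25)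
    {μ : ℝ → Measure (LGConfig 4 (Matrix.specialUnitaryGroup (Fin 2) ℂ))}
    (hμ : ∀ βW ∈ Icc (0 : ℝ) β₁, μ βW ∈ ymGibbsMeasures (d := 4) (fundamentalRep (Fin 2)) (2 * (βW / 4)))
    {F : LGConfig 4 (Matrix.specialUnitaryGroup (Fin 2) ℂ) → ℝ} {Λ : Finset (ZdEdge 4)} {K : ℝ≥0}
    (hF : IsLipschitzCylinder (fundamentalRep (Fin 2)) F Λ K)
    {x₀ : Literature.Probability.LatticeModels.Site 4} {D : ℕ} (hD : ∀ e ∈ Λ, ‖e.1 - x₀‖ ≤ D)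
    (q r : ZdPlaquette 4) {βW : ℝ} (hb : βW ∈ Ioo (0 : ℝ) β₁) :
    HasDerivAt (fun t => U₃[F ; W∗ q ; W∗ r ; μ t]) (∑' s : ZdPlaquette 4, U₄[F ; W∗ q ; W∗ r ; W∗ s ; μ βW]) βW := by
  classical
  obtain ⟨hWq, hWqm, hWq1, -, -⟩ := su2_plaquetteObs_data q
  have hFM : ∀ U, |F U| ≤ ((⟨|F 1| + 2 * K, by positivity⟩ : ℝ≥0) : ℝ) := fun U => hF.abs_le U
  have hDq := plaquetteEdges_norm_sub_le q x₀
  have hFW := isLipschitzCylinder_mul hF hWq hFM hWq1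
  have hDFW := union_norm_sub_le hD hDq
  have hbI : βW ∈ Icc (0 : ℝ) β₁ := ⟨hb.1.le, hb.2.le⟩
  -- the five derivatives
  have dc1 := su2_hasDerivAt_cov_plaquette_star h1 hμ hFW hDFW r hb
  have dm2 := su2_hasDerivAt_integral_star h1 hμ hF hD hb
  have dc2 := su2_hasDerivAt_cov_plaquette_star h1 hμ hWq hDq r hb
  have dm3 := su2_hasDerivAt_integral_star h1 hμ hWq hDq hb
  have dc3 := su2_hasDerivAt_cov_plaquette_star h1 hμ hF hD r hb
  have d := (dc1.fun_sub (dm2.fun_mul dc2)).fun_sub (dm3.fun_mul dc3)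
  refine d.congr_deriv ?_
  -- summability of the five series at `β_W`
  have s1 := (su2_summable_threePoint h1 hbI.1 hbI.2 (hμ βW hbI) hFW hDFW r).1
  have sF := su2_summable_cov_plaquette_star h1 hbI.1 hbI.2 (hμ βW hbI) hF hD
  have s2 := (su2_summable_threePoint h1 hbI.1 hbI.2 (hμ βW hbI) hWq hDq r).1
  have sQ := su2_summable_cov_plaquette_star h1 hbI.1 hbI.2 (hμ βW hbI) hWq hDq
  have s3 := (su2_summable_threePoint h1 hbI.1 hbI.2 (hμ βW hbI) hF hD r).1
  have sF' := sF.mul_right (cov[W∗ q, W∗ r; μ βW])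
  have s2' := s2.mul_left (∫ U, F U ∂(μ βW))
  have sQ' := sQ.mul_right (cov[F, W∗ r; μ βW])
  have s3' := s3.mul_left (∫ U, (W∗ q) U ∂(μ βW))
  rw [(((s1.sub sF').sub s2').sub sQ').tsum_sub s3', ((s1.sub sF').sub s2').tsum_sub sQ', (s1.sub sF').tsum_sub s2',
    s1.tsum_sub sF', tsum_mul_right, tsum_mul_left, tsum_mul_right, tsum_mul_left]
  ring

end OneTerm

/-! ### §3 The double three-point sum is differentiable: the state is `C³` in the coupling -/

section Series

/-- **Summability of the inner three-point sums in `q`**: `q ↦ Σ_r u₃(F; W_q; W_r)_μ` is summable (C-SUS3 domination). -/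
theorem su2_summable_threePointSum {β₁ : ℝ} (h1 : β₁ ≤ 9 / 25) {βW : ℝ} (h0 : 0 ≤ βW) (hβ : βW ≤ β₁)
    {μ : Measure (LGConfig 4 (Matrix.specialUnitaryGroup (Fin 2) ℂ))}
    (hμ : μ ∈ ymGibbsMeasures (d := 4) (fundamentalRep (Fin 2)) (2 * (βW / 4)))
    {F : LGConfig 4 (Matrix.specialUnitaryGroup (Fin 2) ℂ) → ℝ} {Λ : Finset (ZdEdge 4)} {K : ℝ≥0}
    (hF : IsLipschitzCylinder (fundamentalRep (Fin 2)) F Λ K)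
    {x₀ : Literature.Probability.LatticeModels.Site 4} {D : ℕ} (hD : ∀ e ∈ Λ, ‖e.1 - x₀‖ ≤ D) :
    Summable fun q : ZdPlaquette 4 => ∑' r : ZdPlaquette 4, U₃[F ; W∗ q ; W∗ r ; μ] := by
  have hβ₁0 : 0 ≤ β₁ := h0.trans hβ
  have hκ : 0 < starRate (gaugeR β₁) :=
    starRate_pos (gaugeR_nonneg hβ₁0 (by linarith)) (gaugeR_lt_one_of_le hβ₁0 h1)
  set ρ : ℝ := Real.exp (-(starRate (gaugeR β₁) / 16)) with hρ
  set B : ℝ := 2 * (4 * (2 * Real.sqrt 2) ^ 2 * Real.exp (starRate (gaugeR β₁) * (D + 4)) *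
    (128 * (((Λ.card : ℝ) + 4) * (32 * (|F 1| + 2 * K) + K)) + 16384 * (|F 1| + 2 * K) +
      1024 * ((Λ.card : ℝ) * K))) * (numOrient 4 * ((1 + ρ) / (1 - ρ)) ^ 4) with hB
  have hρ0 : 0 ≤ ρ := (Real.exp_pos _).le
  have hρ1 : ρ < 1 := Real.exp_lt_one_iff.2 (by linarith)
  have hK0 : (0 : ℝ) ≤ K := K.2
  have hB0 : 0 ≤ B := by
    have : 0 < 1 - ρ := by linarith
    positivity
  refine Summable.of_norm_bounded (summable_and_tsum_base_le (d := 4) hB0 hρ0 hρ1 x₀).1 (fun q => ?_)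
  obtain ⟨hs, hle⟩ := su2_summable_threePoint h1 h0 hβ hμ hF hD q
  rw [← hρ, ← hB] at hle
  refine (norm_tsum_le_tsum_norm hs.norm).trans ?_
  simpa only [Real.norm_eq_abs] using hle

/-- ★ **The inner sum is differentiable**: for fixed `q`, `d/dβ_W Σ_r u₃(F; W_q; W_r) = Σ_r Σ_s u₄(F; W_q; W_r; W_s)` on
`(0, β₁)` — `hasDerivAt_tsum_of_isPreconnected` under the C-SUS4 domination `Σ_s |u₄| ≤ A₄ G₄ ρ^{‖x₀−x_q‖₁} ρ^{‖x₀−x_r‖₁}`. -/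
theorem su2_hasDerivAt_threePointSum_inner {β₁ : ℝ} (h1 : β₁ ≤ 9 / 25)
    {μ : ℝ → Measure (LGConfig 4 (Matrix.specialUnitaryGroup (Fin 2) ℂ))}
    (hμ : ∀ βW ∈ Icc (0 : ℝ) β₁, μ βW ∈ ymGibbsMeasures (d := 4) (fundamentalRep (Fin 2)) (2 * (βW / 4)))
    {F : LGConfig 4 (Matrix.specialUnitaryGroup (Fin 2) ℂ) → ℝ} {Λ : Finset (ZdEdge 4)} {K : ℝ≥0}
    (hF : IsLipschitzCylinder (fundamentalRep (Fin 2)) F Λ K)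
    {x₀ : Literature.Probability.LatticeModels.Site 4} {D : ℕ} (hD : ∀ e ∈ Λ, ‖e.1 - x₀‖ ≤ D)
    (q : ZdPlaquette 4) {βW : ℝ} (hb : βW ∈ Ioo (0 : ℝ) β₁) :
    HasDerivAt (fun t => ∑' r : ZdPlaquette 4, U₃[F ; W∗ q ; W∗ r ; μ t])
      (∑' r : ZdPlaquette 4, ∑' s : ZdPlaquette 4, U₄[F ; W∗ q ; W∗ r ; W∗ s ; μ βW]) βW := by
  classical
  have hβ₁0 : 0 ≤ β₁ := hb.1.le.trans hb.2.le
  have hκ : 0 < starRate (gaugeR β₁) :=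
    starRate_pos (gaugeR_nonneg hβ₁0 (by linarith)) (gaugeR_lt_one_of_le hβ₁0 h1)
  set ρ : ℝ := Real.exp (-(starRate (gaugeR β₁) / 36)) with hρ
  set A : ℝ := 4 * (2 * Real.sqrt 2) ^ 2 * Real.exp (starRate (gaugeR β₁) * (D + 4)) *
    (40 * ((Λ.card : ℝ) + 4) ^ 2 * (|F 1| + 2 * K + 1) ^ 2 * ((K : ℝ) + 32) ^ 2) with hA
  set G : ℝ := numOrient 4 * ((1 + ρ) / (1 - ρ)) ^ 4 with hG
  have hρ0 : 0 ≤ ρ := (Real.exp_pos _).le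
  have hρ1 : ρ < 1 := Real.exp_lt_one_iff.2 (by linarith)
  have hK0 : (0 : ℝ) ≤ K := K.2
  have hG0 : 0 ≤ G := by
    have : 0 < 1 - ρ := by linarith
    positivity
  have hc : 0 ≤ A * ρ ^ l1 (x₀ - q.1) * G := by positivity
  have hbI : βW ∈ Icc (0 : ℝ) β₁ := ⟨hb.1.le, hb.2.le⟩
  refine hasDerivAt_tsum_of_isPreconnected (summable_and_tsum_base_le (d := 4) hc hρ0 hρ1 x₀).1 isOpen_Ioo
    (convex_Ioo (0 : ℝ) β₁).isPreconnected (fun r t ht => su2_hasDerivAt_threePoint_star h1 hμ hF hD q r ht)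
    (fun r t ht => ?_) hb (su2_summable_threePoint h1 hbI.1 hbI.2 (hμ βW hbI) hF hD q).1 hb
  have htI : t ∈ Icc (0 : ℝ) β₁ := ⟨ht.1.le, ht.2.le⟩
  obtain ⟨hs, hle⟩ := su2_summable_fourPoint h1 htI.1 htI.2 (hμ t htI) hF hD q r
  rw [← hρ, ← hA, ← hG] at hle
  refine (norm_tsum_le_tsum_norm hs.norm).trans ?_
  simp only [Real.norm_eq_abs]
  linarith

/-- ★★ **THE DOUBLE THREE-POINT SUM IS DIFFERENTIABLE IN THE COUPLING** (`SU(2)`, `d = 4`, hypothesis-free): for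
`β₁ ≤ 9/25`, any DLR selection `μ` on `[0, β₁]`, every Lipschitz cylinder `F`, at every `0 < β_W < β₁`:
`d/dβ_W Σ_q Σ_r u₃(F; W_q; W_r)_{μ β_W} = Σ_q Σ_r Σ_s u₄(F; W_q; W_r; W_s)_{μ β_W}` — termwise differentiation under the
uniform summable domination `|Σ_r Σ_s u₄| ≤ A₄ G₄² ρ^{‖x₀−x_q‖₁}` of C-SUS4. -/
theorem su2_hasDerivAt_threePointSum_star {β₁ : ℝ} (h1 : β₁ ≤ 9 / 25)
    {μ : ℝ → Measure (LGConfig 4 (Matrix.specialUnitaryGroup (Fin 2) ℂ))}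
    (hμ : ∀ βW ∈ Icc (0 : ℝ) β₁, μ βW ∈ ymGibbsMeasures (d := 4) (fundamentalRep (Fin 2)) (2 * (βW / 4)))
    {F : LGConfig 4 (Matrix.specialUnitaryGroup (Fin 2) ℂ) → ℝ} {Λ : Finset (ZdEdge 4)} {K : ℝ≥0}
    (hF : IsLipschitzCylinder (fundamentalRep (Fin 2)) F Λ K)
    {x₀ : Literature.Probability.LatticeModels.Site 4} {D : ℕ} (hD : ∀ e ∈ Λ, ‖e.1 - x₀‖ ≤ D)
    {βW : ℝ} (hb : βW ∈ Ioo (0 : ℝ) β₁) :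
    HasDerivAt (fun t => ∑' q : ZdPlaquette 4, ∑' r : ZdPlaquette 4, U₃[F ; W∗ q ; W∗ r ; μ t])
      (∑' q : ZdPlaquette 4, ∑' r : ZdPlaquette 4, ∑' s : ZdPlaquette 4, U₄[F ; W∗ q ; W∗ r ; W∗ s ; μ βW]) βW := by
  classical
  have hβ₁0 : 0 ≤ β₁ := hb.1.le.trans hb.2.le
  have hκ : 0 < starRate (gaugeR β₁) :=
    starRate_pos (gaugeR_nonneg hβ₁0 (by linarith)) (gaugeR_lt_one_of_le hβ₁0 h1)
  set ρ : ℝ := Real.exp (-(starRate (gaugeR β₁) / 36)) with hρ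
  set A : ℝ := 4 * (2 * Real.sqrt 2) ^ 2 * Real.exp (starRate (gaugeR β₁) * (D + 4)) *
    (40 * ((Λ.card : ℝ) + 4) ^ 2 * (|F 1| + 2 * K + 1) ^ 2 * ((K : ℝ) + 32) ^ 2) with hA
  set G : ℝ := numOrient 4 * ((1 + ρ) / (1 - ρ)) ^ 4 with hG
  have hρ0 : 0 ≤ ρ := (Real.exp_pos _).le
  have hρ1 : ρ < 1 := Real.exp_lt_one_iff.2 (by linarith)
  have hK0 : (0 : ℝ) ≤ K := K.2
  have hG0 : 0 ≤ G := by
    have : 0 < 1 - ρ := by linarith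
    positivity
  have hc : 0 ≤ A * G ^ 2 := by positivity
  have hbI : βW ∈ Icc (0 : ℝ) β₁ := ⟨hb.1.le, hb.2.le⟩
  refine hasDerivAt_tsum_of_isPreconnected (summable_and_tsum_base_le (d := 4) hc hρ0 hρ1 x₀).1 isOpen_Ioo
    (convex_Ioo (0 : ℝ) β₁).isPreconnected (fun q t ht => su2_hasDerivAt_threePointSum_inner h1 hμ hF hD q ht)
    (fun q t ht => ?_) hb (su2_summable_threePointSum h1 hbI.1 hbI.2 (hμ βW hbI) hF hD) hb
  have htI : t ∈ Icc (0 : ℝ) β₁ := ⟨ht.1.le, ht.2.le⟩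
  obtain ⟨hs, hle⟩ := su2_summable_fourPoint_two h1 htI.1 htI.2 (hμ t htI) hF hD q
  rw [← hρ, ← hA, ← hG] at hle
  refine (norm_tsum_le_tsum_norm hs).trans (hle.trans (le_of_eq ?_))
  ring

/-- ★★ **THE STATE IS THREE TIMES DIFFERENTIABLE IN THE COUPLING**: for `β₁ ≤ 9/25`, any DLR selection `μ` on `[0, β₁]`,
every Lipschitz cylinder `F` and every `0 < β_W < β₁`:
`d³/dβ_W³ ⟨F⟩_{μ β_W} = Σ_q Σ_r Σ_s u₄(F; W_q; W_r; W_s)_{μ β_W}` (the second derivative `Σ_q Σ_r u₃` of g10's C-DIFF2,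
differentiated once more). -/
theorem su2_hasDerivAt_deriv_deriv_integral_star {β₁ : ℝ} (h1 : β₁ ≤ 9 / 25)
    {μ : ℝ → Measure (LGConfig 4 (Matrix.specialUnitaryGroup (Fin 2) ℂ))}
    (hμ : ∀ βW ∈ Icc (0 : ℝ) β₁, μ βW ∈ ymGibbsMeasures (d := 4) (fundamentalRep (Fin 2)) (2 * (βW / 4)))
    {F : LGConfig 4 (Matrix.specialUnitaryGroup (Fin 2) ℂ) → ℝ} {Λ : Finset (ZdEdge 4)} {K : ℝ≥0}
    (hF : IsLipschitzCylinder (fundamentalRep (Fin 2)) F Λ K)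
    {x₀ : Literature.Probability.LatticeModels.Site 4} {D : ℕ} (hD : ∀ e ∈ Λ, ‖e.1 - x₀‖ ≤ D)
    {βW : ℝ} (hb : βW ∈ Ioo (0 : ℝ) β₁) :
    HasDerivAt (deriv (deriv fun t => ∫ U, F U ∂(μ t)))
      (∑' q : ZdPlaquette 4, ∑' r : ZdPlaquette 4, ∑' s : ZdPlaquette 4, U₄[F ; W∗ q ; W∗ r ; W∗ s ; μ βW]) βW := by
  refine (su2_hasDerivAt_threePointSum_star h1 hμ hF hD hb).congr_of_eventuallyEq ?_
  filter_upwards [Ioo_mem_nhds hb.1 hb.2] with t ht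
  exact (su2_hasDerivAt_deriv_integral_star h1 hμ hF hD ht).deriv

/-- **At the threshold `9/25`**, as functions of `β_W` with the canonical selection `μ_{β_W} ∈ 𝒢(β_W/2)`:
`d³/dβ_W³ ⟨F⟩ = Σ_q Σ_r Σ_s u₄` on `(0, 9/25)`. -/
theorem su2_hasDerivAt_deriv_deriv_integral_9_25
    {μ : ℝ → Measure (LGConfig 4 (Matrix.specialUnitaryGroup (Fin 2) ℂ))}
    (hμ : ∀ βW ∈ Icc (0 : ℝ) (9 / 25), μ βW ∈ ymGibbsMeasures (d := 4) (fundamentalRep (Fin 2)) (2 * (βW / 4)))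
    {F : LGConfig 4 (Matrix.specialUnitaryGroup (Fin 2) ℂ) → ℝ} {Λ : Finset (ZdEdge 4)} {K : ℝ≥0}
    (hF : IsLipschitzCylinder (fundamentalRep (Fin 2)) F Λ K)
    {x₀ : Literature.Probability.LatticeModels.Site 4} {D : ℕ} (hD : ∀ e ∈ Λ, ‖e.1 - x₀‖ ≤ D)
    {βW : ℝ} (hb : βW ∈ Ioo (0 : ℝ) (9 / 25)) :
    HasDerivAt (deriv (deriv fun t => ∫ U, F U ∂(μ t)))
      (∑' q : ZdPlaquette 4, ∑' r : ZdPlaquette 4, ∑' s : ZdPlaquette 4, U₄[F ; W∗ q ; W∗ r ; W∗ s ; μ βW]) βW :=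
  su2_hasDerivAt_deriv_deriv_integral_star le_rfl hμ hF hD hb

end Series

end Summit.Ventures.YMGap.CouplingResponse

end
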